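import Mathlib
import HarnessLib
import Summits.Ventures.LatticeQCDFlow.Exactness.SphereTiltedGreen
import Summits.Ventures.LatticeQCDFlow.Exactness.SphereLatticePoincare

/-!
# A spectral gap for Lüscher's operator `𝓛_t` in `L²(e^{−tS}π̄)` on the lattice of site spheres (Holley–Stroock): `(d−1)e^{−(b−a)}·Var_t(f) ≤ (f, 𝓛_tf)_t` whenever `a ≤ −tS ≤ b` on `Ω`

HONEST FRAMING: exact (Metropolis-corrected) sampling algorithms for lattice gauge theory;
figures of merit are autocorrelation/cost numbers at stated couplings and volumes; no
continuum-physics claim.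

Venture `LatticeQCDFlow` (cell pub-lqcd), topic `Exactness`; FANOUT row 7 (`s0-cpn-null`).  NEW WORK
of the cell over the tree's `Exactness/SphereTiltedGreen.lean` (this leg: `sphereLuscherL`, the energy
identity `∫e^{−tS}f·𝓛_tf dπ̄ = Σ_k∫e^{−tS}‖∂̃_kf‖²dπ̄`), `Exactness/SphereLatticePolynomialPoincare.lean`
(GEN-10: the gap `(d−1)∫(f−c₀)² ≤ Σ∫‖∂̃f‖²` under `⊗σ` for lattice polynomials, general `E`),
`Exactness/SphereLuscherRecursionVariance.lean` (GEN-11: its `π̄`-form `poincare_polyS_uniform`) and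
`Exactness/SphereLatticePoincare.lean` (GEN-8: the gap for all `C²` functionals, `E = ℝ^{m+2}`);
nothing is cited as a fact (the perturbation argument is the textbook one of Holley–Stroock, J. Stat.
Phys. 46 (1987) 1159, NAMED ONLY).  Printed counterpart, NAMED ONLY: M. Lüscher, Commun. Math. Phys.
293 (2010) 899, §4.2 after eq. (4.8): `𝓛_t` "has purely discrete spectrum", its zero modes are the
constants, and (App. E) it is boundedly invertible on their orthogonal complement — the input for the
existence of the flow action at `t ≠ 0`.  THIS FILE gives the sphere-side QUANTITATIVE form of the gap
at every real flow time `t`: if `a ≤ −tS ≤ b` on `Ω` then for every lattice polynomial `f` (general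
finite-dimensional `E`, `d = dim E ≥ 2`) and for every `C²` functional (`E = ℝ^{m+2}`)
`(d−1)·∫e^{−tS}(f − ⟨f⟩_t)²dπ̄ ≤ e^{b−a}·∫e^{−tS}f·𝓛_tf dπ̄`, i.e. the gap of `𝓛_t` in `L²(μ_t)`,
`μ_t = e^{−tS}π̄/Z(t)`, is at least `(d−1)e^{−(b−a)}` — with `b − a ≤ 2|t|·sup_Ω|S|`, a volume-dependent
but explicit constant (the honest price of the perturbation argument).

## Content

* §1 weights: `integral_mul_le_exp_mul_integral` / `exp_mul_integral_le_integral_mul` (`e^a∫g ≤ ∫e^{−tS}g ≤ e^b∫g`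
  for `g ≥ 0`), `tilted_variance_le` (the tilted mean square deviation is least at the tilted mean).
* §2 **`holleyStroock_transfer`** — from a `π̄`-Poincaré datum `γ∫(h−c₀)²dπ̄ ≤ D̄` and a weighted
  Dirichlet datum to `γ·∫e^{−tS}(h − ⟨h⟩_t)²dπ̄ ≤ e^{b−a}·D_t`.
* §3 **`tilted_spectral_gap_polyS`** (lattice polynomials, general `E`) and
  **`tilted_spectral_gap_euclidean`** (all `C²` functionals, `E = ℝ^{m+2}`):
  `(d−1)·∫e^{−tS}(f − ⟨f⟩_t)²dπ̄ ≤ e^{b−a}·∫e^{−tS}f·𝓛_tf dπ̄`; `exists_action_bounds` (`a`, `b` exist by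
  compactness, so the gap is positive at every `t`).

NOT CLAIMED: volume-independent gap constants at `t ≠ 0`; existence of the finite-`t` flow action
(needs the gap on a complete space, not only on polynomials / `C²`); anything about the rung.
-/

noncomputable section

namespace Summit.Ventures.LatticeQCDFlow.Exactness

open Function Set Metric MeasureTheory NormedSpace InnerProductSpace
open scoped RealInnerProductSpace

variable {Λ : Type*} {E : Type*} [NormedAddCommGroup E] [InnerProductSpace ℝ E]
  [FiniteDimensional ℝ E] [MeasurableSpace E] [BorelSpace E] [Fintype Λ] [Nontrivial E]

/-! ## §1 Weights and the tilted variance -/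

section Weights

variable {S : (Λ → E) → ℝ} {t a b : ℝ}

omit [InnerProductSpace ℝ E] [FiniteDimensional ℝ E] [MeasurableSpace E] [BorelSpace E] [Fintype Λ]
  [Nontrivial E] in
/-- `a ≤ −tS ≤ b` on `Ω` bounds the weight: `e^a ≤ e^{−tS} ≤ e^b`. -/
theorem exp_weight_bounds (hlo : ∀ ω : Λ → sphere (0 : E) 1, a ≤ -(t * S (fun m => (ω m : E))))
    (hhi : ∀ ω : Λ → sphere (0 : E) 1, -(t * S (fun m => (ω m : E))) ≤ b)
    (ω : Λ → sphere (0 : E) 1) :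
    Real.exp a ≤ Real.exp (-(t * S (fun m => (ω m : E)))) ∧
      Real.exp (-(t * S (fun m => (ω m : E)))) ≤ Real.exp b :=
  ⟨Real.exp_le_exp.2 (hlo ω), Real.exp_le_exp.2 (hhi ω)⟩

/-- **Upper weight bound**: `∫e^{−tS}g dπ̄ ≤ e^b·∫g dπ̄` for continuous `g ≥ 0`. -/
theorem integral_mul_le_exp_mul_integral
    (hhi : ∀ ω : Λ → sphere (0 : E) 1, -(t * S (fun m => (ω m : E))) ≤ b)
    {g : (Λ → sphere (0 : E) 1) → ℝ} (hg : Continuous g) (hg0 : ∀ ω, 0 ≤ g ω) :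
    ∫ ω, Real.exp (-(t * S (fun m => ((ω : Λ → sphere (0 : E) 1) m : E)))) * g ω
        ∂Measure.pi (fun _ : Λ => uniformSphere (volume : Measure E)) ≤
      Real.exp b * ∫ ω, g ω ∂Measure.pi (fun _ : Λ => uniformSphere (volume : Measure E)) := by
  rw [← integral_const_mul]
  refine integral_mono_of_nonneg (ae_of_all _ fun ω => mul_nonneg (Real.exp_pos _).le (hg0 ω))
    ((integrable_pi_of_continuous _ hg).const_mul _) (ae_of_all _ fun ω => ?_)
  exact mul_le_mul_of_nonneg_right (Real.exp_le_exp.2 (hhi ω)) (hg0 ω)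

/-- **Lower weight bound**: `e^a·∫g dπ̄ ≤ ∫e^{−tS}g dπ̄` for continuous `g ≥ 0`. -/
theorem exp_mul_integral_le_integral_mul (hS : Continuous S)
    (hlo : ∀ ω : Λ → sphere (0 : E) 1, a ≤ -(t * S (fun m => (ω m : E))))
    {g : (Λ → sphere (0 : E) 1) → ℝ} (hg : Continuous g) (hg0 : ∀ ω, 0 ≤ g ω) :
    Real.exp a * ∫ ω, g ω ∂Measure.pi (fun _ : Λ => uniformSphere (volume : Measure E)) ≤
      ∫ ω, Real.exp (-(t * S (fun m => ((ω : Λ → sphere (0 : E) 1) m : E)))) * g ω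
        ∂Measure.pi (fun _ : Λ => uniformSphere (volume : Measure E)) := by
  rw [← integral_const_mul]
  refine integral_mono_of_nonneg (ae_of_all _ fun ω => mul_nonneg (Real.exp_pos _).le (hg0 ω))
    (integrable_pi_of_continuous _ ((continuous_exp_neg_mul_sphereConfig hS t).mul hg))
    (ae_of_all _ fun ω => ?_)
  exact mul_le_mul_of_nonneg_right (Real.exp_le_exp.2 (hlo ω)) (hg0 ω)

/-- **The tilted mean square deviation is least at the tilted mean**: with `Z = ∫e^{−tS}dπ̄` and
`c_t = (∫e^{−tS}h dπ̄)/Z`, `∫e^{−tS}(h − c_t)² dπ̄ ≤ ∫e^{−tS}(h − c)² dπ̄` for every constant `c`. -/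
theorem tilted_variance_le (hS : Continuous S) {h : (Λ → sphere (0 : E) 1) → ℝ} (hh : Continuous h)
    (c : ℝ) :
    ∫ ω, Real.exp (-(t * S (fun m => ((ω : Λ → sphere (0 : E) 1) m : E)))) *
        (h ω - (∫ ω', Real.exp (-(t * S (fun m => ((ω' : Λ → sphere (0 : E) 1) m : E)))) * h ω'
            ∂Measure.pi (fun _ : Λ => uniformSphere (volume : Measure E))) /
          ∫ ω', Real.exp (-(t * S (fun m => ((ω' : Λ → sphere (0 : E) 1) m : E))))
            ∂Measure.pi (fun _ : Λ => uniformSphere (volume : Measure E))) ^ 2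
        ∂Measure.pi (fun _ : Λ => uniformSphere (volume : Measure E)) ≤
      ∫ ω, Real.exp (-(t * S (fun m => ((ω : Λ → sphere (0 : E) 1) m : E)))) * (h ω - c) ^ 2
        ∂Measure.pi (fun _ : Λ => uniformSphere (volume : Measure E)) := by
  set μ : Measure (sphere (0 : E) 1) := uniformSphere (volume : Measure E) with hμ
  set w : (Λ → sphere (0 : E) 1) → ℝ := fun ω => Real.exp (-(t * S (fun m => (ω m : E)))) with hw
  have hwc : Continuous w := continuous_exp_neg_mul_sphereConfig hS t
  set Z : ℝ := ∫ ω, w ω ∂Measure.pi (fun _ : Λ => μ) with hZ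
  set M : ℝ := ∫ ω, w ω * h ω ∂Measure.pi (fun _ : Λ => μ) with hM
  have hZpos : 0 < Z := integral_exp_pos (integrable_pi_of_continuous _ hwc)
  set ct : ℝ := M / Z with hct
  -- expand `(h − c)² = (h − ct)² + 2(ct − c)(h − ct) + (ct − c)²` against the weight
  have hi1 : Integrable (fun ω => w ω * (h ω - ct) ^ 2) (Measure.pi fun _ : Λ => μ) :=
    integrable_pi_of_continuous μ (hwc.mul ((hh.sub continuous_const).pow 2))
  have hi2 : Integrable (fun ω => 2 * (ct - c) * (w ω * (h ω - ct))) (Measure.pi fun _ : Λ => μ) :=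
    (integrable_pi_of_continuous μ (hwc.mul (hh.sub continuous_const))).const_mul _
  have hi3 : Integrable (fun ω => (ct - c) ^ 2 * w ω) (Measure.pi fun _ : Λ => μ) :=
    (integrable_pi_of_continuous μ hwc).const_mul _
  have hi12 : Integrable (fun ω => w ω * (h ω - ct) ^ 2 + 2 * (ct - c) * (w ω * (h ω - ct)))
      (Measure.pi fun _ : Λ => μ) := hi1.add hi2
  have hfun : (fun ω => w ω * (h ω - c) ^ 2) =
      fun ω => w ω * (h ω - ct) ^ 2 + 2 * (ct - c) * (w ω * (h ω - ct)) + (ct - c) ^ 2 * w ω := by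
    funext ω; ring
  have hcross : ∫ ω, w ω * (h ω - ct) ∂Measure.pi (fun _ : Λ => μ) = 0 := by
    have hi4 : Integrable (fun ω => w ω * h ω) (Measure.pi fun _ : Λ => μ) :=
      integrable_pi_of_continuous μ (hwc.mul hh)
    have hi5 : Integrable (fun ω => ct * w ω) (Measure.pi fun _ : Λ => μ) :=
      (integrable_pi_of_continuous μ hwc).const_mul _
    have hfun' : (fun ω => w ω * (h ω - ct)) = fun ω => w ω * h ω - ct * w ω := by
      funext ω; ring
    rw [hfun', integral_sub hi4 hi5, integral_const_mul, ← hM, ← hZ, hct,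
      div_mul_cancel₀ _ hZpos.ne', sub_self]
  rw [hfun, integral_add hi12 hi3, integral_add hi1 hi2, integral_const_mul, integral_const_mul,
    hcross, mul_zero, add_zero]
  nlinarith [sq_nonneg (ct - c), hZpos.le]

end Weights

/-! ## §2 The Holley–Stroock transfer -/

section Transfer

variable {S : (Λ → E) → ℝ} {t a b : ℝ}

/-- **HOLLEY–STROOCK TRANSFER on the lattice of site spheres.**  Let `h, D` be continuous on `Ω` with
`D ≥ 0`, and suppose the a-priori inequality `γ·∫(h − c₀)²dπ̄ ≤ ∫D dπ̄` for some constant `c₀` and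
`γ ≥ 0`.  If `a ≤ −tS ≤ b` on `Ω`, then with the tilted mean `c_t = ∫e^{−tS}h/∫e^{−tS}`:
`γ·∫e^{−tS}(h − c_t)²dπ̄ ≤ e^{b−a}·∫e^{−tS}D dπ̄`. -/
theorem holleyStroock_transfer (hS : Continuous S)
    (hlo : ∀ ω : Λ → sphere (0 : E) 1, a ≤ -(t * S (fun m => (ω m : E))))
    (hhi : ∀ ω : Λ → sphere (0 : E) 1, -(t * S (fun m => (ω m : E))) ≤ b)
    {h D : (Λ → sphere (0 : E) 1) → ℝ} (hh : Continuous h) (hD : Continuous D) (hD0 : ∀ ω, 0 ≤ D ω)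
    {γ c₀ : ℝ} (hγ : 0 ≤ γ)
    (hgap : γ * ∫ ω, (h ω - c₀) ^ 2 ∂Measure.pi (fun _ : Λ => uniformSphere (volume : Measure E)) ≤
      ∫ ω, D ω ∂Measure.pi (fun _ : Λ => uniformSphere (volume : Measure E))) :
    γ * ∫ ω, Real.exp (-(t * S (fun m => ((ω : Λ → sphere (0 : E) 1) m : E)))) *
        (h ω - (∫ ω', Real.exp (-(t * S (fun m => ((ω' : Λ → sphere (0 : E) 1) m : E)))) * h ω'
            ∂Measure.pi (fun _ : Λ => uniformSphere (volume : Measure E))) /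
          ∫ ω', Real.exp (-(t * S (fun m => ((ω' : Λ → sphere (0 : E) 1) m : E))))
            ∂Measure.pi (fun _ : Λ => uniformSphere (volume : Measure E))) ^ 2
        ∂Measure.pi (fun _ : Λ => uniformSphere (volume : Measure E)) ≤
      Real.exp (b - a) * ∫ ω, Real.exp (-(t * S (fun m => ((ω : Λ → sphere (0 : E) 1) m : E)))) * D ω
        ∂Measure.pi (fun _ : Λ => uniformSphere (volume : Measure E)) := by
  -- (1) tilted variance ≤ tilted mean square deviation from `c₀`
  have h1 := tilted_variance_le (t := t) hS hh c₀
  -- (2) weight above by `e^b`, a-priori gap, weight below by `e^a`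
  have h2 := integral_mul_le_exp_mul_integral (t := t) hhi (g := fun ω => (h ω - c₀) ^ 2)
    ((hh.sub continuous_const).pow 2) (fun ω => sq_nonneg (h ω - c₀))
  have h3 := exp_mul_integral_le_integral_mul (t := t) hS hlo hD hD0
  have hea : 0 < Real.exp a := Real.exp_pos a
  have hDint : 0 ≤ ∫ ω, D ω ∂Measure.pi (fun _ : Λ => uniformSphere (volume : Measure E)) :=
    integral_nonneg hD0
  have hba : Real.exp (b - a) = Real.exp b / Real.exp a := by rw [Real.exp_sub]
  calc γ * ∫ ω, Real.exp (-(t * S (fun m => ((ω : Λ → sphere (0 : E) 1) m : E)))) *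
          (h ω - (∫ ω', Real.exp (-(t * S (fun m => ((ω' : Λ → sphere (0 : E) 1) m : E)))) * h ω'
              ∂Measure.pi (fun _ : Λ => uniformSphere (volume : Measure E))) /
            ∫ ω', Real.exp (-(t * S (fun m => ((ω' : Λ → sphere (0 : E) 1) m : E))))
              ∂Measure.pi (fun _ : Λ => uniformSphere (volume : Measure E))) ^ 2
          ∂Measure.pi (fun _ : Λ => uniformSphere (volume : Measure E))
      ≤ γ * (Real.exp b * ∫ ω, (h ω - c₀) ^ 2
          ∂Measure.pi (fun _ : Λ => uniformSphere (volume : Measure E))) :=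
        mul_le_mul_of_nonneg_left (h1.trans h2) hγ
    _ = Real.exp b * (γ * ∫ ω, (h ω - c₀) ^ 2
          ∂Measure.pi (fun _ : Λ => uniformSphere (volume : Measure E))) := by ring
    _ ≤ Real.exp b * ∫ ω, D ω ∂Measure.pi (fun _ : Λ => uniformSphere (volume : Measure E)) :=
        mul_le_mul_of_nonneg_left hgap (Real.exp_pos b).le
    _ = Real.exp (b - a) * (Real.exp a *
          ∫ ω, D ω ∂Measure.pi (fun _ : Λ => uniformSphere (volume : Measure E))) := by
        rw [hba]; field_simp
    _ ≤ _ := mul_le_mul_of_nonneg_left h3 (Real.exp_pos _).le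

omit [MeasurableSpace E] [BorelSpace E] [Fintype Λ] [Nontrivial E] in
/-- **Bounds `a ≤ −tS ≤ b` on `Ω` exist** for every continuous action and every `t` (compactness). -/
theorem exists_action_bounds (hS : Continuous S) (t : ℝ) :
    ∃ a b : ℝ, (∀ ω : Λ → sphere (0 : E) 1, a ≤ -(t * S (fun m => (ω m : E)))) ∧
      ∀ ω : Λ → sphere (0 : E) 1, -(t * S (fun m => (ω m : E))) ≤ b := by
  have hc : Continuous fun ω : Λ → sphere (0 : E) 1 => -(t * S (fun m => (ω m : E))) :=
    (continuous_const.mul (hS.comp continuous_sphereConfig)).neg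
  obtain ⟨B, hB⟩ := isCompact_univ.exists_bound_of_continuousOn hc.continuousOn
  refine ⟨-B, B, fun ω => ?_, fun ω => ?_⟩
  · have h := hB ω (mem_univ ω)
    rw [Real.norm_eq_abs] at h
    exact neg_le_of_abs_le h
  · have h := hB ω (mem_univ ω)
    rw [Real.norm_eq_abs] at h
    exact le_of_abs_le h

end Transfer

/-! ## §3 The gap of `𝓛_t` -/

section Gap

variable [DecidableEq Λ] {S : (Λ → E) → ℝ} {t a b : ℝ}

/-- **SPECTRAL GAP OF `𝓛_t` ON LATTICE POLYNOMIALS** (general finite-dimensional `E`, `d = dim E ≥ 2`,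
every finite `Λ`, every real `t`): if `a ≤ −tS ≤ b` on `Ω` (`S ∈ C¹`), then for every lattice
polynomial `f`, with `c_t` its tilted mean,
`(d−1)·∫e^{−tS}(f − c_t)²dπ̄ ≤ e^{b−a}·∫e^{−tS}f·𝓛_tf dπ̄` — in `L²(μ_t)`:
`(f − ⟨f⟩_t, f − ⟨f⟩_t)_t ≤ e^{b−a}/(d−1)·(f, 𝓛_tf)_t`. -/
theorem tilted_spectral_gap_polyS (h2 : 2 ≤ Module.finrank ℝ E) (hS : ContDiff ℝ 1 S)
    (hlo : ∀ ω : Λ → sphere (0 : E) 1, a ≤ -(t * S (fun m => (ω m : E))))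
    (hhi : ∀ ω : Λ → sphere (0 : E) 1, -(t * S (fun m => (ω m : E))) ≤ b)
    {N : ℕ} {f : (Λ → E) → ℝ} (hf : f ∈ polyS Λ E N) :
    ((Module.finrank ℝ E : ℝ) - 1) *
        ∫ ω, Real.exp (-(t * S (fun m => ((ω : Λ → sphere (0 : E) 1) m : E)))) *
          (f (fun m => (ω m : E)) -
            (∫ ω', Real.exp (-(t * S (fun m => ((ω' : Λ → sphere (0 : E) 1) m : E)))) *
                f (fun m => (ω' m : E)) ∂Measure.pi (fun _ : Λ => uniformSphere (volume : Measure E))) /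
              ∫ ω', Real.exp (-(t * S (fun m => ((ω' : Λ → sphere (0 : E) 1) m : E))))
                ∂Measure.pi (fun _ : Λ => uniformSphere (volume : Measure E))) ^ 2
          ∂Measure.pi (fun _ : Λ => uniformSphere (volume : Measure E)) ≤
      Real.exp (b - a) * ∫ ω, Real.exp (-(t * S (fun m => ((ω : Λ → sphere (0 : E) 1) m : E)))) *
          f (fun m => (ω m : E)) * sphereLuscherL S t f (fun m => (ω m : E))
        ∂Measure.pi (fun _ : Λ => uniformSphere (volume : Measure E)) := by
  have hfC : ContDiff ℝ 2 f := (contDiff_infty.1 (contDiff_of_mem_polyS hf)) 2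
  rw [integral_exp_mul_self_sphereLuscherL hS hfC t]
  -- the a-priori gap under `π̄` (transferred from `⊗σ`)
  obtain ⟨c₀, hc₀⟩ := poincare_polyS (Λ := Λ) h2 hf
  have hd : 0 ≤ (Module.finrank ℝ E : ℝ) - 1 := by
    have : (2 : ℝ) ≤ Module.finrank ℝ E := by exact_mod_cast h2
    linarith
  have hgk : ∀ k, Continuous fun ω : Λ → sphere (0 : E) 1 =>
      ‖siteGrad k f (fun n => (ω n : E))‖ ^ 2 := fun k =>
    ((continuous_siteGrad_sphereConfig (hfC.of_le (by norm_num)) k).norm).pow 2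
  have hwgk : ∀ k, Continuous fun ω : Λ → sphere (0 : E) 1 =>
      Real.exp (-(t * S (fun m => (ω m : E)))) * ‖siteGrad k f (fun n => (ω n : E))‖ ^ 2 := fun k =>
    (continuous_exp_neg_mul_sphereConfig hS.continuous t).mul (hgk k)
  have hgap : ((Module.finrank ℝ E : ℝ) - 1) *
      ∫ ω, (f (fun n => ((ω : Λ → sphere (0 : E) 1) n : E)) - c₀) ^ 2
        ∂Measure.pi (fun _ : Λ => uniformSphere (volume : Measure E)) ≤
      ∫ ω, ∑ k, ‖siteGrad k f (fun n => ((ω : Λ → sphere (0 : E) 1) n : E))‖ ^ 2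
        ∂Measure.pi (fun _ : Λ => uniformSphere (volume : Measure E)) := by
    rw [integral_finsetSum _ fun k _ => integrable_pi_of_continuous _ (hgk k)]
    simp_rw [integral_pi_uniformSphere_eq_mul, ← Finset.mul_sum]
    calc _ = (((((volume : Measure E).toSphere univ)⁻¹) ^ Fintype.card Λ).toReal) *
          (((Module.finrank ℝ E : ℝ) - 1) *
            ∫ ω, (f (fun n => ((ω : Λ → sphere (0 : E) 1) n : E)) - c₀) ^ 2
              ∂Measure.pi (fun _ : Λ => (volume : Measure E).toSphere)) := by ring
      _ ≤ _ := mul_le_mul_of_nonneg_left hc₀ toReal_inv_toSphere_pow_pos.le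
  have hD : Continuous fun ω : Λ → sphere (0 : E) 1 =>
      ∑ k, ‖siteGrad k f (fun n => (ω n : E))‖ ^ 2 := continuous_finsetSum _ fun k _ => hgk k
  have hmain := holleyStroock_transfer (t := t) hS.continuous hlo hhi
    (hfC.continuous.comp continuous_sphereConfig) hD
    (fun ω => Finset.sum_nonneg fun k _ => sq_nonneg _) hd hgap
  refine hmain.trans (le_of_eq ?_)
  congr 1
  rw [← integral_finsetSum _ fun k _ => integrable_pi_of_continuous _ (hwgk k)]
  refine integral_congr_ae (ae_of_all _ fun ω => ?_)
  simp only [Finset.mul_sum]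

end Gap

section GapEuclidean

variable [DecidableEq Λ] {m : ℕ} {S : (Λ → EuclideanSpace ℝ (Fin (m + 2))) → ℝ} {t a b : ℝ}

/-- **SPECTRAL GAP OF `𝓛_t` ON ALL `C²` FUNCTIONALS, `E = ℝ^{m+2}`** (every finite `Λ`, every real `t`):
if `a ≤ −tS ≤ b` on `Ω` then `(m+1)·∫e^{−tS}(F − ⟨F⟩_t)²dπ̄ ≤ e^{b−a}·∫e^{−tS}F·𝓛_tF dπ̄`. -/
theorem tilted_spectral_gap_euclidean (hS : ContDiff ℝ 1 S)
    (hlo : ∀ ω : Λ → sphere (0 : EuclideanSpace ℝ (Fin (m + 2))) 1,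
      a ≤ -(t * S (fun n => (ω n : EuclideanSpace ℝ (Fin (m + 2))))))
    (hhi : ∀ ω : Λ → sphere (0 : EuclideanSpace ℝ (Fin (m + 2))) 1,
      -(t * S (fun n => (ω n : EuclideanSpace ℝ (Fin (m + 2))))) ≤ b)
    {F : (Λ → EuclideanSpace ℝ (Fin (m + 2))) → ℝ} (hF : ContDiff ℝ 2 F) :
    ((m : ℝ) + 1) *
        ∫ ω, Real.exp (-(t * S (fun n => ((ω : Λ → sphere (0 : EuclideanSpace ℝ (Fin (m + 2))) 1) n :
            EuclideanSpace ℝ (Fin (m + 2)))))) *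
          (F (fun n => (ω n : EuclideanSpace ℝ (Fin (m + 2)))) -
            (∫ ω', Real.exp (-(t * S (fun n =>
                ((ω' : Λ → sphere (0 : EuclideanSpace ℝ (Fin (m + 2))) 1) n :
                  EuclideanSpace ℝ (Fin (m + 2)))))) *
                F (fun n => (ω' n : EuclideanSpace ℝ (Fin (m + 2))))
                ∂Measure.pi (fun _ : Λ =>
                  uniformSphere (volume : Measure (EuclideanSpace ℝ (Fin (m + 2)))))) /
              ∫ ω', Real.exp (-(t * S (fun n =>
                ((ω' : Λ → sphere (0 : EuclideanSpace ℝ (Fin (m + 2))) 1) n :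
                  EuclideanSpace ℝ (Fin (m + 2))))))
                ∂Measure.pi (fun _ : Λ =>
                  uniformSphere (volume : Measure (EuclideanSpace ℝ (Fin (m + 2)))))) ^ 2
          ∂Measure.pi (fun _ : Λ => uniformSphere (volume : Measure (EuclideanSpace ℝ (Fin (m + 2))))) ≤
      Real.exp (b - a) *
        ∫ ω, Real.exp (-(t * S (fun n => ((ω : Λ → sphere (0 : EuclideanSpace ℝ (Fin (m + 2))) 1) n :
            EuclideanSpace ℝ (Fin (m + 2)))))) *
          F (fun n => (ω n : EuclideanSpace ℝ (Fin (m + 2)))) *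
            sphereLuscherL S t F (fun n => (ω n : EuclideanSpace ℝ (Fin (m + 2))))
          ∂Measure.pi (fun _ : Λ => uniformSphere (volume : Measure (EuclideanSpace ℝ (Fin (m + 2))))) := by
  rw [integral_exp_mul_self_sphereLuscherL hS hF t]
  have hP := lattice_sphere_poincare (Λ := Λ) hF
  have hd : 0 ≤ (m : ℝ) + 1 := by positivity
  have hFc : Continuous fun ω : Λ → sphere (0 : EuclideanSpace ℝ (Fin (m + 2))) 1 =>
      F (fun n => (ω n : EuclideanSpace ℝ (Fin (m + 2)))) := hF.continuous.comp continuous_sphereConfig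
  -- rewrite the variance `∫F² − (∫F)²` as `∫(F − ∫F)²`
  set c₀ : ℝ := ∫ ω, F (fun n => ((ω : Λ → sphere (0 : EuclideanSpace ℝ (Fin (m + 2))) 1) n :
      EuclideanSpace ℝ (Fin (m + 2))))
    ∂Measure.pi (fun _ : Λ => uniformSphere (volume : Measure (EuclideanSpace ℝ (Fin (m + 2))))) with hc₀
  have hvar : ∫ ω, (F (fun n => ((ω : Λ → sphere (0 : EuclideanSpace ℝ (Fin (m + 2))) 1) n :
        EuclideanSpace ℝ (Fin (m + 2)))) - c₀) ^ 2
        ∂Measure.pi (fun _ : Λ => uniformSphere (volume : Measure (EuclideanSpace ℝ (Fin (m + 2))))) =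
      (∫ ω, F (fun n => ((ω : Λ → sphere (0 : EuclideanSpace ℝ (Fin (m + 2))) 1) n :
          EuclideanSpace ℝ (Fin (m + 2)))) ^ 2
          ∂Measure.pi (fun _ : Λ => uniformSphere (volume : Measure (EuclideanSpace ℝ (Fin (m + 2)))))) -
        c₀ ^ 2 := by
    set μ := Measure.pi (fun _ : Λ => uniformSphere (volume : Measure (EuclideanSpace ℝ (Fin (m + 2)))))
      with hμ
    have hi1 : Integrable (fun ω : Λ → sphere (0 : EuclideanSpace ℝ (Fin (m + 2))) 1 =>
        F (fun n => (ω n : EuclideanSpace ℝ (Fin (m + 2)))) ^ 2) μ :=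
      integrable_pi_of_continuous _ (hFc.pow 2)
    have hi2 : Integrable (fun ω : Λ → sphere (0 : EuclideanSpace ℝ (Fin (m + 2))) 1 =>
        2 * c₀ * F (fun n => (ω n : EuclideanSpace ℝ (Fin (m + 2))))) μ :=
      (integrable_pi_of_continuous _ hFc).const_mul _
    have hi12 : Integrable (fun ω : Λ → sphere (0 : EuclideanSpace ℝ (Fin (m + 2))) 1 =>
        F (fun n => (ω n : EuclideanSpace ℝ (Fin (m + 2)))) ^ 2 -
          2 * c₀ * F (fun n => (ω n : EuclideanSpace ℝ (Fin (m + 2))))) μ := hi1.sub hi2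
    have hfun : (fun ω : Λ → sphere (0 : EuclideanSpace ℝ (Fin (m + 2))) 1 =>
        (F (fun n => (ω n : EuclideanSpace ℝ (Fin (m + 2)))) - c₀) ^ 2) =
        fun ω => F (fun n => (ω n : EuclideanSpace ℝ (Fin (m + 2)))) ^ 2 -
          2 * c₀ * F (fun n => (ω n : EuclideanSpace ℝ (Fin (m + 2)))) + c₀ ^ 2 := by
      funext ω; ring
    rw [hfun, integral_add hi12 (integrable_const _), integral_sub hi1 hi2, integral_const_mul,
      ← hc₀, integral_const, smul_eq_mul, Measure.real, measure_univ, ENNReal.toReal_one, one_mul]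
    ring
  have hgk : ∀ k, Continuous fun ω : Λ → sphere (0 : EuclideanSpace ℝ (Fin (m + 2))) 1 =>
      ‖siteGrad k F (fun n => (ω n : EuclideanSpace ℝ (Fin (m + 2))))‖ ^ 2 := fun k =>
    ((continuous_siteGrad_sphereConfig (hF.of_le (by norm_num)) k).norm).pow 2
  have hwgk : ∀ k, Continuous fun ω : Λ → sphere (0 : EuclideanSpace ℝ (Fin (m + 2))) 1 =>
      Real.exp (-(t * S (fun n => (ω n : EuclideanSpace ℝ (Fin (m + 2)))))) *
        ‖siteGrad k F (fun n => (ω n : EuclideanSpace ℝ (Fin (m + 2))))‖ ^ 2 := fun k =>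
    (continuous_exp_neg_mul_sphereConfig hS.continuous t).mul (hgk k)
  have hgap : ((m : ℝ) + 1) *
      ∫ ω, (F (fun n => ((ω : Λ → sphere (0 : EuclideanSpace ℝ (Fin (m + 2))) 1) n :
          EuclideanSpace ℝ (Fin (m + 2)))) - c₀) ^ 2
        ∂Measure.pi (fun _ : Λ => uniformSphere (volume : Measure (EuclideanSpace ℝ (Fin (m + 2))))) ≤
      ∫ ω, ∑ k, ‖siteGrad k F (fun n => ((ω : Λ → sphere (0 : EuclideanSpace ℝ (Fin (m + 2))) 1) n :
          EuclideanSpace ℝ (Fin (m + 2))))‖ ^ 2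
        ∂Measure.pi (fun _ : Λ => uniformSphere (volume : Measure (EuclideanSpace ℝ (Fin (m + 2))))) := by
    rw [hvar, integral_finsetSum _ fun k _ => integrable_pi_of_continuous _ (hgk k)]
    exact hP
  have hD : Continuous fun ω : Λ → sphere (0 : EuclideanSpace ℝ (Fin (m + 2))) 1 =>
      ∑ k, ‖siteGrad k F (fun n => (ω n : EuclideanSpace ℝ (Fin (m + 2))))‖ ^ 2 :=
    continuous_finsetSum _ fun k _ => hgk k
  have hmain := holleyStroock_transfer (t := t) hS.continuous hlo hhi hFc hD
    (fun ω => Finset.sum_nonneg fun k _ => sq_nonneg _) hd hgap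
  refine hmain.trans (le_of_eq ?_)
  congr 1
  rw [← integral_finsetSum _ fun k _ => integrable_pi_of_continuous _ (hwgk k)]
  refine integral_congr_ae (ae_of_all _ fun ω => ?_)
  simp only [Finset.mul_sum]

end GapEuclidean

end Summit.Ventures.LatticeQCDFlow.Exactness

end
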